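import Summits.ResolutionOfSingularities.ResolutionOfSingularities.Theorems.WeightedInvariantRatContactDescentDimTwo
import Summits.ResolutionOfSingularities.ResolutionOfSingularities.Theorems.WeightedInvariantIota3SigmaRatioEssSmooth
import Summits.ResolutionOfSingularities.ResolutionOfSingularities.Theorems.WeightedInvariantKeyRungThreeOfSigmaExt
import Summits.ResolutionOfSingularities.ResolutionOfSingularities.Theorems.WeightedInvariantIota3SigmaPointwise
import Summits.ResolutionOfSingularities.ResolutionOfSingularities.Theorems.WeightedInvariantIota3FlagBridge
import Mathlib.Algebra.Order.Floor.Div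
import HarnessLib

/-!
# (σ-ext) BELOW DIMENSION THREE: in dimension two the two-flag filtration collapses to the one-flag one for EVERY admissible `q`, the
# level letter reads `ω`, and σ descends by the dimension-two one-member descent; hence (σ-ext)≤3 ⟸ (σ-ext)=3 and the gap list of
# `stub_keyRungGrHomLE_three` with (σ-ext) AT EQUAL DIMENSION THREE ONLY (door `HypersurfaceCentreConstruction`, stmt-ResolutionOfSingularities-19897)

Topic: `Summits/ResolutionOfSingularities/ResolutionOfSingularities/Theorems`. Helper for the door item `HypersurfaceCentreConstruction`
(stmt-ResolutionOfSingularities-19897, route `WeightedInvariant`), line `local-engine` (skeleton v3.12 `7a4b52ef`), def-free.  Sequel of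
`keyRungGrHomLE_three_of_sigmaExt` (…KeyRungThreeOfSigmaExt, p819102), whose hypothesis (σ-ext) quantifies over all 𝔪-preserving local formally
smooth e.f.t. homomorphisms `φ : A → A'` of regular local rings with `dim A' ≤ 3`.  Since `𝔪_A A' = 𝔪_{A'}` forces `dim A = dim A'`
(`ringKrullDim_eq_of_map_maximalIdeal_eq`), (σ-ext) splits by the common dimension `d ∈ {0, 1, 2, 3}`:

* `d ≤ 1`: no two-flag exists, `σ = ω` on both sides (tree: `Iota3.iotaSigma_eq_omega0_of_ringKrullDim_le_one`).
* `d = 2` (THIS FILE): every two-flag is a regular system of parameters, so (§1) `flagContactFiltration g₁ g₂ q r₁ r₂ = ratContactFiltration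
  g₁ r₁ r₂` for EVERY admissible `q` (`𝔪 ⊆ F(r₂)`), hence `FlagReaches f ν q r₁ r₂ ↔ OneFlagReaches f ν r₁ r₂` (§2); reached triples
  rescale (`(q; r₁, r₂) ↦ (1; k r₁, k r₂)`), so a non-empty level set is unbounded and the LEVEL letter is `ω` for every `f` (§2,
  `iotaSigmaLevel_eq_omega0_of_ringKrullDim_eq_two`); the RATIO letter descends by `RatContactCone.oneFlagReaches_of_algebraMap_dim2`
  (…RatContactDescentDimTwo, p819409).  So **`iotaSigma_algebraMap_eq_dim2`**: σ is invariant at `d = 2`.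
* `d = 3`: the remaining hypothesis **(σ-ext)₃** (ratio letter in tree: `JFlatEssSmooth.iotaSigmaRatio_algebraMap_eq`; level letter = σ-maximiser
  descent, open).

§4 `sigmaExt_of_sigmaExt_three` : (σ-ext) ⟸ (σ-ext)₃, and **`keyRungGrHomLE_three_of_sigmaExt3`** — the gap list with FIVE hypotheses
(desc-τ), (σ-ext)₃, GAP 2, hgame, the residue of the dominance word at the power positions.

[OURS · L1 W4.3 · audit glue + dimension-two kernel lemmas]  Replaces the role of NO printed item; NOT a statement of the manuscript
[claim: Hironaka2017, status: under-review]; candidates stay candidates; AI work, weaker than expert review.  No definition; no axiom; every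
clause input is a hypothesis.

## References

* H. Hironaka, *Characteristic polyhedra of singularities*, J. Math. Kyoto Univ. 7 (1967), §3. [Hironaka1967]
* H. Matsumura, *Commutative Ring Theory* (1987), Thm. 14.2, Thm. 15.4. [Matsumura1987]
-/

noncomputable section

set_option linter.dupNamespace false -- mandated namespace `Summit.<Summit>.<Problem>` of this single-conjunct summit

open IsLocalRing Literature.AlgebraicGeometry.Resolution
open Summit.ResolutionOfSingularities.ResolutionOfSingularities.Theorems
open Summit.ResolutionOfSingularities.ResolutionOfSingularities.Cruxes.HypersurfaceCentreConstruction.LocalEngine.Iota3.RatContact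

namespace Summit.ResolutionOfSingularities.ResolutionOfSingularities.Cruxes.HypersurfaceCentreConstruction.LocalEngine

namespace Iota3

/-! ## §1 The one-flag collapse for every admissible `q` when the flag generates `𝔪` -/

section Collapse

variable {S : Type} [CommRing S] [IsLocalRing S]

/-- **Weight `1` costs nothing when the flag generates `𝔪`**: if `𝔪 ⊆ (g₁, g₂)` then for every admissible `(q; r₁, r₂)` the coarse
filtration (`q = r₂`) lies in the fine one (`q`): a piece `(g₁^α g₂^β) 𝔪^c` sits in `F(r₁α + r₂β) · F(r₂)^c ⊆ F(r₁α + r₂β + r₂c) ⊆ F(n)`.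
[folklore] -/
theorem flagContactFiltration_r₂_le_of_maximalIdeal_le {g₁ g₂ : S} (hspan : maximalIdeal S ≤ Ideal.span {g₁, g₂}) {q r₁ r₂ : ℕ}
    (hadm : AdmissibleTriple q r₁ r₂) (n : ℕ) :
    flagContactFiltration g₁ g₂ r₂ r₁ r₂ n ≤ flagContactFiltration g₁ g₂ q r₁ r₂ n := by
  obtain ⟨hq, hqr₂, hr₂r₁⟩ := hadm
  have hr₂ : 0 < r₂ := lt_of_lt_of_le hq hqr₂
  have h𝔪 : maximalIdeal S ≤ flagContactFiltration g₁ g₂ q r₁ r₂ r₂ := by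
    refine hspan.trans ?_
    rw [Ideal.span_le]
    rintro x (rfl | rfl)
    · exact flagContactFiltration_antitone _ _ q r₁ r₂ hr₂r₁ (self_mem_flagContactFiltration _ g₂ r₁ r₂ hq).1
    · exact (self_mem_flagContactFiltration g₁ _ r₁ r₂ hq).2
  rw [flagContactFiltration_def g₁ g₂ r₂ r₁ r₂ n]
  refine iSup_le fun α => iSup_le fun β => ?_
  have hpow : maximalIdeal S ^ ((n - r₁ * α - r₂ * β + r₂ - 1) / r₂) ≤
      flagContactFiltration g₁ g₂ q r₁ r₂ (r₂ * ((n - r₁ * α - r₂ * β + r₂ - 1) / r₂)) :=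
    (Ideal.pow_right_mono h𝔪 _).trans (pow_le_flagContactFiltration_mul g₁ g₂ r₁ r₂ hq r₂ _)
  have hmono : Ideal.span {g₁ ^ α * g₂ ^ β} ≤ flagContactFiltration g₁ g₂ q r₁ r₂ (r₁ * α + r₂ * β) := by
    rw [Ideal.span_singleton_le_iff_mem]
    have h := mul_mem_flagContactFiltration_of_weight (g₁ := g₁) (g₂ := g₂) (r₁ := r₁) (r₂ := r₂) (n := r₁ * α + r₂ * β)
      (α := α) (β := β) (k := 0) (c := 1) hq (by simp) (by simp)
    simpa using h
  refine (Ideal.mul_mono hmono hpow).trans ((flagContactFiltration_mul_le g₁ g₂ q r₁ r₂ hq _ _).trans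
    (flagContactFiltration_antitone g₁ g₂ q r₁ r₂ ?_))
  -- `x ≤ r₂ ⌈x / r₂⌉` for `x = n - r₁α - r₂β`
  have h : n - r₁ * α - r₂ * β ≤ r₂ * ((n - r₁ * α - r₂ * β + r₂ - 1) / r₂) := by
    rw [← Nat.ceilDiv_eq_add_pred_div]
    have h' : (n - r₁ * α - r₂ * β) ⌈/⌉ r₂ ≤ (n - r₁ * α - r₂ * β) ⌈/⌉ r₂ := le_rfl
    rwa [ceilDiv_le_iff_le_smul hr₂, smul_eq_mul] at h'
  omega

/-- **THE ONE-FLAG COLLAPSE FOR EVERY ADMISSIBLE `q`**: if `g₂ ∈ 𝔪 ⊆ (g₁, g₂)` (the flag is a system of parameters — automatic in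
dimension two) then `flagContactFiltration g₁ g₂ q r₁ r₂ n = ratContactFiltration g₁ r₁ r₂ n` for every admissible `(q; r₁, r₂)`.
[folklore] -/
theorem flagContactFiltration_eq_ratContactFiltration_of_maximalIdeal_le {g₁ g₂ : S} (hg₂ : g₂ ∈ maximalIdeal S)
    (hspan : maximalIdeal S ≤ Ideal.span {g₁, g₂}) {q r₁ r₂ : ℕ} (hadm : AdmissibleTriple q r₁ r₂) (n : ℕ) :
    flagContactFiltration g₁ g₂ q r₁ r₂ n = ratContactFiltration g₁ r₁ r₂ n :=
  le_antisymm (flagContactFiltration_le_ratContactFiltration hg₂ hadm.1 hadm.2.1 n)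
    ((ratContactFiltration_le_flagContactFiltration g₁ g₂ r₁ r₂ n).trans
      (flagContactFiltration_r₂_le_of_maximalIdeal_le hspan hadm n))

/-- `⌈kx/(kb)⌉ = ⌈x/b⌉`. [folklore] -/
theorem mul_ceilDiv_mul {k b : ℕ} (hk : 0 < k) (hb : 0 < b) (x : ℕ) : (k * x) ⌈/⌉ (k * b) = x ⌈/⌉ b := by
  have key : ∀ c : ℕ, (k * x) ⌈/⌉ (k * b) ≤ c ↔ x ⌈/⌉ b ≤ c := fun c => by
    rw [ceilDiv_le_iff_le_smul (Nat.mul_pos hk hb), ceilDiv_le_iff_le_smul hb, smul_eq_mul, smul_eq_mul, mul_assoc]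
    exact ⟨fun h => Nat.le_of_mul_le_mul_left h hk, fun h => Nat.mul_le_mul_left k h⟩
  exact le_antisymm ((key _).mpr le_rfl) ((key _).mp le_rfl)

/-- **Rescaling a rational slope**: `RC_g(ka, kb)(kaν) = RC_g(a, b)(aν)` (`k > 0`). [folklore] -/
theorem ratContactFiltration_scale (g : S) {a b k : ℕ} (hb : 0 < b) (hk : 0 < k) (ν : ℕ) :
    ratContactFiltration g (k * a) (k * b) (k * a * ν) = ratContactFiltration g a b (a * ν) := by
  rw [ratContactFiltration_def, ratContactFiltration_def]
  refine iSup_congr fun α => ?_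
  have e : k * a * ν - k * a * α = k * (a * ν - a * α) := by rw [mul_assoc, mul_assoc, ← mul_tsub]
  rw [e, ← Nat.ceilDiv_eq_add_pred_div, ← Nat.ceilDiv_eq_add_pred_div, mul_ceilDiv_mul hk hb]

/-- The degenerate reaches: `f = 0` or `ν = 0` reaches every slope along every parameter (`0 < b`). [folklore] -/
theorem oneFlagReaches_of_eq_zero_or {f g : S} (hg : g ∈ maximalIdeal S) (hg2 : g ∉ maximalIdeal S ^ 2) {ν a b : ℕ} (hb : 0 < b)
    (h : f = 0 ∨ ν = 0) : OneFlagReaches f ν a b := by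
  refine ⟨g, hg, hg2, ?_⟩
  rcases h with rfl | rfl
  · exact Ideal.zero_mem _
  · rw [mul_zero, ratContactFiltration_def]
    refine Ideal.mem_iSup_of_mem 0 ?_
    have h0 : (0 - a * 0 + b - 1) / b = 0 := Nat.div_eq_of_lt (by omega)
    rw [h0, pow_zero, pow_zero, Ideal.span_singleton_one, mul_one]
    exact Submodule.mem_top

end Collapse

/-! ## §2 Dimension two: flags are systems of parameters; the level letter reads `ω` -/

section DimTwo

variable {S : Type} [CommRing S] [IsRegularLocalRing S]

/-- In a regular local ring of dimension `2`, `emb dim = 2`. [folklore] -/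
theorem spanFinrank_eq_two_of_ringKrullDim (hdim : ringKrullDim S = (2 : ℕ)) : (maximalIdeal S).spanFinrank = 2 := by
  have h := IsRegularLocalRing.spanFinrank_maximalIdeal (R := S)
  rw [hdim] at h
  exact_mod_cast h

/-- **In dimension two a one-flag reach is a two-flag reach for EVERY admissible `q`** (complete the parameter to a regular system
`(g, g₂)`; it generates `𝔪`, so the collapse of §1 applies). [cite: Matsumura1987, Thm. 14.2] -/
theorem flagReaches_of_oneFlagReaches_dim2 (hdim : ringKrullDim S = (2 : ℕ)) {f : S} {ν q a b : ℕ} (hadm : AdmissibleTriple q a b)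
    (h : OneFlagReaches f ν a b) : FlagReaches f ν q a b := by
  obtain ⟨g, hg, hg2, hmem⟩ := h
  have hd2 := spanFinrank_eq_two_of_ringKrullDim hdim
  obtain ⟨z, hz, hz0⟩ := exists_rsop_apply_eq hd2 hg hg2 (0 : Fin 2)
  have hfl : IsTwoFlag (z 0) (z 1) := isTwoFlag_of_rsp hd2 z hz (i := 0) (j := 1) (by decide)
  have hrange : Set.range z = {z 0, z 1} := by
    ext t
    simp only [Set.mem_range, Set.mem_insert_iff, Set.mem_singleton_iff]
    constructor
    · rintro ⟨i, hi⟩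
      fin_cases i
      · exact Or.inl hi.symm
      · exact Or.inr hi.symm
    · rintro (h | h)
      · exact ⟨0, h.symm⟩
      · exact ⟨1, h.symm⟩
  have hspan : maximalIdeal S ≤ Ideal.span {z 0, z 1} := by rw [← hrange, hz]
  refine ⟨z 0, z 1, hfl, ?_⟩
  rw [flagContactFiltration_eq_ratContactFiltration_of_maximalIdeal_le hfl.2.1 hspan hadm, hz0]
  exact hmem

/-- **In dimension two `FlagReaches f ν q r₁ r₂ ↔ OneFlagReaches f ν r₁ r₂`** for admissible `(q; r₁, r₂)`. [folklore] -/
theorem flagReaches_iff_oneFlagReaches_dim2 (hdim : ringKrullDim S = (2 : ℕ)) {f : S} {ν q r₁ r₂ : ℕ}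
    (hadm : AdmissibleTriple q r₁ r₂) : FlagReaches f ν q r₁ r₂ ↔ OneFlagReaches f ν r₁ r₂ :=
  ⟨FlagReaches.oneFlagReaches hadm, flagReaches_of_oneFlagReaches_dim2 hdim hadm⟩

/-- **Reached triples rescale in dimension two**: `(q; r₁, r₂)` reached ⇒ `(1; k r₁, k r₂)` reached (`k > 0`). [folklore] -/
theorem flagReaches_rescale_dim2 (hdim : ringKrullDim S = (2 : ℕ)) {f : S} {ν q r₁ r₂ : ℕ} (hadm : AdmissibleTriple q r₁ r₂)
    {k : ℕ} (hk : 0 < k) (h : FlagReaches f ν q r₁ r₂) : FlagReaches f ν 1 (k * r₁) (k * r₂) := by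
  have hr₂ : 0 < r₂ := lt_of_lt_of_le hadm.1 hadm.2.1
  have hadm' : AdmissibleTriple 1 (k * r₁) (k * r₂) :=
    ⟨Nat.one_pos, Nat.mul_pos hk hr₂, Nat.mul_le_mul_left k hadm.2.2⟩
  obtain ⟨g, hg, hg2, hmem⟩ := (flagReaches_iff_oneFlagReaches_dim2 hdim hadm).mp h
  refine flagReaches_of_oneFlagReaches_dim2 hdim hadm' ⟨g, hg, hg2, ?_⟩
  rw [ratContactFiltration_scale g hr₂ hk]
  exact hmem

/-- **In dimension two a non-empty level set is unbounded** (rescale the witnessing triple). [folklore] -/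
theorem not_bddAbove_levelSet_of_nonempty_dim2 (hdim : ringKrullDim S = (2 : ℕ)) (f : S) (hne : (levelSet f).Nonempty) :
    ¬ BddAbove (levelSet f) := by
  obtain ⟨m, q, r₁, r₂, hadm, hreach, hratio, -⟩ := hne
  rintro ⟨N, hN⟩
  have hr₂ : 0 < r₂ := lt_of_lt_of_le hadm.1 hadm.2.1
  have hr₁ : 0 < r₁ := lt_of_lt_of_le hr₂ hadm.2.2
  have hD : 0 < levelScale (adicOrder f).toNat (sigmaRatioNat f) := Nat.factorial_pos _
  -- the element `D (N+1) r₁` of the level set, witnessed by `(1; (N+1) r₁, (N+1) r₂)`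
  have hmem : levelScale (adicOrder f).toNat (sigmaRatioNat f) * ((N + 1) * r₁) ∈ levelSet f := by
    refine ⟨1, (N + 1) * r₁, (N + 1) * r₂, ⟨Nat.one_pos, Nat.mul_pos N.succ_pos hr₂, Nat.mul_le_mul_left _ hadm.2.2⟩,
      flagReaches_rescale_dim2 hdim hadm N.succ_pos hreach, ?_, by rw [mul_one]⟩
    calc ratioScale (adicOrder f).toNat * ((N + 1) * r₁) = (N + 1) * (ratioScale (adicOrder f).toNat * r₁) := by ring
      _ = (N + 1) * (sigmaRatioNat f * r₂) := by rw [hratio]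
      _ = sigmaRatioNat f * ((N + 1) * r₂) := by ring
  have hle := hN hmem
  have h1 : N + 1 ≤ levelScale (adicOrder f).toNat (sigmaRatioNat f) * ((N + 1) * r₁) :=
    calc N + 1 = 1 * ((N + 1) * 1) := by ring
      _ ≤ levelScale (adicOrder f).toNat (sigmaRatioNat f) * ((N + 1) * r₁) :=
        Nat.mul_le_mul hD (Nat.mul_le_mul_left _ hr₁)
  omega

/-- **THE LEVEL LETTER READS `ω` IN DIMENSION TWO**, for every `f` (the level set is empty or unbounded). [folklore] -/
theorem iotaSigmaLevel_eq_omega0_of_ringKrullDim_eq_two (hdim : ringKrullDim S = (2 : ℕ)) (f : S) :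
    iotaSigmaLevel S f = Ordinal.omega0 :=
  iotaSigmaLevel_eq_omega0 S f fun ⟨hb, hne⟩ => not_bddAbove_levelSet_of_nonempty_dim2 hdim f hne hb

/-- A regular parameter exists in dimension two. [folklore] -/
theorem exists_regular_parameter_dim2 (hdim : ringKrullDim S = (2 : ℕ)) : ∃ x ∈ maximalIdeal S, x ∉ maximalIdeal S ^ 2 :=
  SetLike.exists_of_lt (IsLocalRing.maximalIdeal_sq_lt_of_ringKrullDim_ne_zero (by rw [hdim]; norm_num))

end DimTwo

/-! ## §3 (σ-ext) at dimension two, at dimension `≤ 1`, and the dimension bookkeeping -/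

section SigmaExtTwo

variable {S S' : Type} [CommRing S] [CommRing S'] [IsRegularLocalRing S] [IsRegularLocalRing S'] [Algebra S S']
  [IsLocalHom (algebraMap S S')] [Algebra.FormallySmooth S S'] [Algebra.EssFiniteType S S']

/-- **One-member descent in dimension two for EVERY `f`** (the cases `f = 0` / `f` a unit reach everything). [cite: Hironaka1967, §3] -/
theorem oneFlagReaches_of_algebraMap_dim2' (h𝔪 : (maximalIdeal S).map (algebraMap S S') = maximalIdeal S')
    (hdim : ringKrullDim S = (2 : ℕ)) (hdim' : ringKrullDim S' = (2 : ℕ)) (f : S) {b : ℕ} (hb : 0 < b) (a : ℕ)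
    (h : OneFlagReaches (algebraMap S S' f) (adicOrder f).toNat a b) : OneFlagReaches f (adicOrder f).toNat a b := by
  obtain ⟨x, hx, hx2⟩ := exists_regular_parameter_dim2 hdim
  by_cases hf0 : f = 0
  · exact oneFlagReaches_of_eq_zero_or hx hx2 hb (Or.inl hf0)
  by_cases hfu : IsUnit f
  · exact oneFlagReaches_of_eq_zero_or hx hx2 hb (Or.inr (by rw [(adicOrder_eq_zero_iff f).mpr hfu]; rfl))
  have hf : f ∈ maximalIdeal S := (IsLocalRing.mem_maximalIdeal f).mpr (mem_nonunits_iff.mpr hfu)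
  exact RatContactCone.oneFlagReaches_of_algebraMap_dim2 h𝔪 hdim hdim' hf0 hf hb a h

/-- **The ratio witness sets coincide along `φ` in dimension two.** [cite: Hironaka1967, §3] -/
theorem flagReaches_algebraMap_iff_dim2 (h𝔪 : (maximalIdeal S).map (algebraMap S S') = maximalIdeal S')
    (hdim : ringKrullDim S = (2 : ℕ)) (hdim' : ringKrullDim S' = (2 : ℕ)) (f : S) {q r₁ r₂ : ℕ} (hadm : AdmissibleTriple q r₁ r₂) :
    FlagReaches (algebraMap S S' f) (adicOrder f).toNat q r₁ r₂ ↔ FlagReaches f (adicOrder f).toNat q r₁ r₂ := by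
  haveI : Module.Flat S S' := IotaOrderEssSmooth.flat_of_formallySmooth_of_essFiniteType S S'
  refine ⟨fun h => ?_, fun h => h.algebraMap_of_flat h𝔪⟩
  have hr₂ : 0 < r₂ := lt_of_lt_of_le hadm.1 hadm.2.1
  exact flagReaches_of_oneFlagReaches_dim2 hdim hadm
    (oneFlagReaches_of_algebraMap_dim2' h𝔪 hdim hdim' f hr₂ r₁ (FlagReaches.oneFlagReaches hadm h))

/-- **THE RATIO LETTER IS COMPATIBLE WITH `φ` IN DIMENSION TWO.** [cite: Hironaka1967, §3] -/
theorem sigmaRatioNat_algebraMap_eq_dim2 (h𝔪 : (maximalIdeal S).map (algebraMap S S') = maximalIdeal S')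
    (hdim : ringKrullDim S = (2 : ℕ)) (hdim' : ringKrullDim S' = (2 : ℕ)) (f : S) :
    sigmaRatioNat (algebraMap S S' f) = sigmaRatioNat f := by
  haveI : Module.Flat S S' := IotaOrderEssSmooth.flat_of_formallySmooth_of_essFiniteType S S'
  unfold sigmaRatioNat
  rw [adicOrder_algebraMap_eq_of_flat h𝔪]
  congr 1
  ext m
  simp only [Set.mem_setOf_eq]
  constructor
  · rintro ⟨q, r₁, r₂, hadm, hreach, hle⟩
    exact ⟨q, r₁, r₂, hadm, (flagReaches_algebraMap_iff_dim2 h𝔪 hdim hdim' f hadm).mp hreach, hle⟩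
  · rintro ⟨q, r₁, r₂, hadm, hreach, hle⟩
    exact ⟨q, r₁, r₂, hadm, (flagReaches_algebraMap_iff_dim2 h𝔪 hdim hdim' f hadm).mpr hreach, hle⟩

/-- **(σ-ext) AT DIMENSION TWO**: `σ(S', φ f) = σ(S, f)` along a 𝔪-preserving local formally smooth e.f.t. `φ : S → S'` of regular local
rings of dimension two (ratio: one-member descent by the cone trick; level: `ω = ω`). [cite: Hironaka1967, §3] [OURS · L1 W4.3 · (σ-ext)₂] -/
theorem iotaSigma_algebraMap_eq_dim2 (h𝔪 : (maximalIdeal S).map (algebraMap S S') = maximalIdeal S')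
    (hdim : ringKrullDim S = (2 : ℕ)) (hdim' : ringKrullDim S' = (2 : ℕ)) (f : S) :
    iotaSigma S' (algebraMap S S' f) = iotaSigma S f := by
  have h1 : iotaSigmaRatio S' (algebraMap S S' f) = iotaSigmaRatio S f := by
    rw [iotaSigmaRatio_eq, iotaSigmaRatio_eq, sigmaRatioNat_algebraMap_eq_dim2 h𝔪 hdim hdim' f]
  have h2 : iotaSigmaLevel S' (algebraMap S S' f) = iotaSigmaLevel S f := by
    rw [iotaSigmaLevel_eq_omega0_of_ringKrullDim_eq_two hdim', iotaSigmaLevel_eq_omega0_of_ringKrullDim_eq_two hdim]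
  unfold iotaSigma
  exact (iotaLex_eq_iff iotaSigmaLevel_boundedBy S' (algebraMap S S' f) S f).mpr ⟨h1, h2⟩

omit [IsLocalHom (algebraMap S S')] [Algebra.FormallySmooth S S'] [Algebra.EssFiniteType S S'] in
/-- **(σ-ext) AT DIMENSION `≤ 1`**: both sides read `ω`. [folklore] -/
theorem iotaSigma_algebraMap_eq_of_ringKrullDim_le_one (hdim : ringKrullDim S ≤ 1) (hdim' : ringKrullDim S' ≤ 1) (f : S) :
    iotaSigma S' (algebraMap S S' f) = iotaSigma S f := by
  rw [iotaSigma_eq_omega0_of_ringKrullDim_le_one hdim', iotaSigma_eq_omega0_of_ringKrullDim_le_one hdim]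

/-- **`𝔪_S S' = 𝔪_{S'}` forces equal dimension** (the closed fibre is the residue field). [cite: Matsumura1987, Thm. 15.1] -/
theorem ringKrullDim_eq_of_map_maximalIdeal_eq (h𝔪 : (maximalIdeal S).map (algebraMap S S') = maximalIdeal S') :
    ringKrullDim S = ringKrullDim S' := by
  obtain ⟨a, b, c, ha, hb, hc, habc⟩ := EssSmoothLE2.exists_dims S S'
  have hc0 : ringKrullDim (S' ⧸ (maximalIdeal S).map (algebraMap S S')) = 0 := by
    rw [h𝔪]
    exact ringKrullDim_eq_zero_of_isField ((Ideal.Quotient.maximal_ideal_iff_isField_quotient _).mp inferInstance)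
  rw [hc0] at hc
  have hc' : c = 0 := by exact_mod_cast hc.symm
  rw [ha, hb, habc, hc', add_zero]

end SigmaExtTwo

/-! ## §4 (σ-ext) ⟸ (σ-ext)₃, and the gap list -/

/-- **(σ-ext) FROM ITS EQUAL-DIMENSION-THREE CASE**: along a 𝔪-preserving local formally smooth e.f.t. `φ : A → A'` of regular local rings
with `dim A' ≤ 3`, `σ(A', φ g) = σ(A, g)` — given the case `dim A = dim A' = 3`.  Dimensions `≤ 1`: `ω = ω`; dimension `2`:
`iotaSigma_algebraMap_eq_dim2`. [OURS · L1 W4.3 · audit glue] -/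
theorem sigmaExt_of_sigmaExt_three
    (hσext3 : ∀ (A A' : Type) [CommRing A] [IsRegularLocalRing A] [CommRing A'] [IsRegularLocalRing A'] [Algebra A A']
      [IsLocalHom (algebraMap A A')] [Algebra.FormallySmooth A A'] [Algebra.EssFiniteType A A'] (g : A),
      ringKrullDim A = (3 : ℕ) → ringKrullDim A' = (3 : ℕ) → (maximalIdeal A).map (algebraMap A A') = maximalIdeal A' →
      iotaSigma A' (algebraMap A A' g) = iotaSigma A g) :
    ∀ (A A' : Type) [CommRing A] [IsRegularLocalRing A] [CommRing A'] [IsRegularLocalRing A'] [Algebra A A']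
      [IsLocalHom (algebraMap A A')] [Algebra.FormallySmooth A A'] [Algebra.EssFiniteType A A'] (g : A),
      ringKrullDim A' ≤ 3 → (maximalIdeal A).map (algebraMap A A') = maximalIdeal A' → iotaSigma A' (algebraMap A A' g) = iotaSigma A g := by
  intro A A' _ _ _ _ _ _ _ _ g hdim' h𝔪
  have hdims := ringKrullDim_eq_of_map_maximalIdeal_eq (S := A) (S' := A') h𝔪
  obtain ⟨b, hb⟩ := exists_ringKrullDim_eq_natCast A'
  have hb3 : b ≤ 3 := by have h := hdim'; rw [hb] at h; exact_mod_cast h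
  have ha : ringKrullDim A = (b : ℕ) := hdims.trans hb
  rcases Nat.lt_or_ge b 2 with hb1 | hb2
  · have hle : ((b : ℕ) : WithBot ℕ∞) ≤ 1 := by exact_mod_cast (show b ≤ 1 by omega)
    exact iotaSigma_algebraMap_eq_of_ringKrullDim_le_one (hdim := by rw [ha]; exact hle) (hdim' := by rw [hb]; exact hle) g
  rcases Nat.lt_or_ge b 3 with hb2' | hb3'
  · have hb2 : b = 2 := by omega
    subst hb2
    exact iotaSigma_algebraMap_eq_dim2 h𝔪 ha hb g
  · have hb3 : b = 3 := by omega
    subst hb3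
    exact hσext3 A A' g ha hb h𝔪

end Iota3

open Iota3 in
/-- **P3 RUNG FOR THE NAMED PAIR MODULO FIVE HYPOTHESES, (σ-ext) AT EQUAL DIMENSION THREE ONLY**: (desc-τ), **(σ-ext)₃** «σ is invariant
along 𝔪-preserving local formally smooth e.f.t. homomorphisms of regular local rings OF DIMENSION THREE», GAP 2, hgame, the residue of the
dominance word at the power positions.  (σ-ext) at dimension `≤ 2` is discharged by this file (`sigmaExt_of_sigmaExt_three`).
[OURS · L1 W4.3 · audit glue] -/
theorem keyRungGrHomLE_three_of_sigmaExt3 (p : ℕ)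
    (hD : ∀ (T T' : Type) [CommRing T] [IsRegularLocalRing T] [CommRing T'] [IsRegularLocalRing T'] [Algebra T T']
      [IsLocalHom (algebraMap T T')] [Algebra.FormallySmooth T T'] [Algebra.EssFiniteType T T'] (g : T),
      ringKrullDim T' ≤ 3 → IsTiePosition T' (algebraMap T T' g) → IsTiePosition T g)
    (hσext3 : ∀ (A A' : Type) [CommRing A] [IsRegularLocalRing A] [CommRing A'] [IsRegularLocalRing A'] [Algebra A A']
      [IsLocalHom (algebraMap A A')] [Algebra.FormallySmooth A A'] [Algebra.EssFiniteType A A'] (g : A),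
      ringKrullDim A = (3 : ℕ) → ringKrullDim A' = (3 : ℕ) → (maximalIdeal A).map (algebraMap A A') = maximalIdeal A' →
      iotaSigma A' (algebraMap A A' g) = iotaSigma A g)
    (hgap2 : ∀ (T T' : Type) [CommRing T] [IsRegularLocalRing T] [CommRing T'] [IsRegularLocalRing T'] [Algebra T T']
      [IsLocalHom (algebraMap T T')] [Algebra.FormallySmooth T T'] [Algebra.EssFiniteType T T'] (g : T),
      ringKrullDim T' ≤ 3 → (maximalIdeal T).map (algebraMap T T') = maximalIdeal T' → ringKrullDim T = (3 : ℕ) →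
      iotaEps T g = 0 → ∀ m : ℕ, jSigmaPt T' (algebraMap T T' g) m = (jSigmaPt T g m).map (algebraMap T T'))
    (hgame : CanonicalGameClauseHomLE 3 p iotaFlatT jFlatT)
    (hres : ∀ (k₀ : Type) [Field k₀] [CharP k₀ p] [PerfectField k₀]
      (S : Type) [CommRing S] [Algebra k₀ S] [Algebra.EssFiniteType k₀ S] [IsRegularLocalRing S] (f : S),
      ringKrullDim S = (3 : ℕ) → f ≠ 0 → f ∈ (maximalIdeal S) ^ 2 →
      ContactCylinder.topStratumPrime iotaOrdEpsTau S f = maximalIdeal S → iotaEps S f ≠ 1 →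
      (∃ ℓ ∈ maximalIdeal S, f ∈ Ideal.span {ℓ ^ (adicOrder f).toNat} ⊔ maximalIdeal S ^ ((adicOrder f).toNat + 1)) →
      ∀ (a b : ℕ), 0 < b →
      (∀ q' r₁' r₂' : ℕ, AdmissibleTriple q' r₁' r₂' → FlagReaches f (adicOrder f).toNat q' r₁' r₂' → r₁' * b ≤ a * r₂') →
      ∀ (g₁ g₂ g₁' g₂' : S) (q r₁ r₂ : ℕ), AdmissibleTriple q r₁ r₂ → r₁ * b = a * r₂ → q < r₂ → r₂ < r₁ →
        IsTwoFlag g₁ g₂ → IsTwoFlag g₁' g₂' →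
        f ∈ flagContactFiltration g₁ g₂ q r₁ r₂ (r₁ * (adicOrder f).toNat) →
        f ∈ flagContactFiltration g₁' g₂' q r₁ r₂ (r₁ * (adicOrder f).toNat) →
        g₂' ∈ flagContactFiltration g₁ g₂ q r₁ r₂ r₂) :
    KeyRungGrHomLE 3 p :=
  keyRungGrHomLE_three_of_sigmaExt p hD (sigmaExt_of_sigmaExt_three hσext3) hgap2 hgame hres

end Summit.ResolutionOfSingularities.ResolutionOfSingularities.Cruxes.HypersurfaceCentreConstruction.LocalEngine

end
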